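import Summits.QuantumFields.YangMills.Theorems.BalabanUVNodesN15KingModelCurvedH

/-!
# BalabanUVNodes ∕ N15 — THE KING-MODEL RUNG, CURVED EDITION (PART D): NE2's SITE-LAYER OBJECT FOR THE INTERNAL SLICES `G^η_{(j)}`
# **WITH THE BACKGROUND `A`** ON THE MULTISCALE SLICE CARRIER (sites of scale `j`, size `L^jη`, King's scale-covariant rate factor), and
# its η-rate BY NAME FROM KING'S PRINTED PROPOSITION 3.9 (3.73) (`King1986.SlicePropagator.Prop39Printed`) — point fibres, carrier, pairing,
# index, sup entries, step bounds (no slack)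
# (Track A, DAG node N15 = NE2; FAN-OUT v1.1 §N15 s3 «KING-MODEL RUNG … + the one-line statement of what the curved case adds»)

HONEST FRAMING.  Count-neutral kernel bookkeeping (cell `pub-ymgap`, seat `pub-ymgap-dag-n15-e` g4, strategy s3 «alternative currency: located
caveat admitted as hypothesis»; `--supports stmt-QuantumFields-19908 --as helper` = K3′ `SpineGivenEndpointR12`, lineage K3 19676).  The input
is the HYPOTHESIS SCHEMA `SlicePropagator.Prop39Printed T C δ₀ γ` — C. King's Proposition 3.9 for the U(1)-Higgs model in `d = 2, 3` WITH a regular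
background `A` ([King1986] p. 665, printed AND proved in print, §4 p. 675 there), typed verbatim over ABSTRACT two-spacing data `T : TwoSpacing d`
by the cell's literature seat (`King1986/SlicePropagatorStatements.lean`; King's operators with `A ≠ 0` are not constructed there or here).
This file CONSUMES the schema by name and proves nothing of King's and nothing of Bałaban's: NOT the covariant propagators `G(U)`, `G′(U)` of
[Balaban1985BackgroundPropagators] Thms 3.1∕3.3, for which NE2⁺ is NOT PRINTED and not proved; NOT a node discharge; nothing continuum ∕
ℝ⁴ ∕ OS ∕ mass-gap ∕ Clay.  0 `sorry`, standard axioms; the `def`s are plumbing (a point-fibre structure on the abstract data, two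
inert-argument geometries per slice, a pairing, an index, two sup entries, two site kernels).

THE POINT.  The node's site-kernel shape was DESIGNED on King's (3.73): `T4EtaRate`'s rate factor `(η∕L^jη)^γ` at a site of physical size
`L^jη` is, by `T4EtaRate.rateFactor_eq_king`, King's printed factor `L^{−γk}(L^jη)^{−γ}` of Proposition 3.9 p. 665, verbatim: *"**Proposition
3.9.** For 0 ≤ j ≤ k − 1, 0 < α < 1, and γ sufficiently small, |G^{η′}_{(j)}(x′, y′) − G^η_{(j)}(x, y)|, |∂^{η′}_μG^{η′}_{(j)}(x′, y′) −
∂^η_μG^η_{(j)}(x, y)| ≤ CL^{−γk}{(L^jη)^{2−d−γ}, (L^jη)^{1−d−γ}} exp[−δ₀(L^jη)^{−1}|x − y|], (3.73)"* (with p. 664: *"When x′ ∈ T_{η′}, we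
denote by x that point in T_η for which x′ ∈ B^n(x)"*).  Parts A–C of this rung read the UNIT-scale objects (the H-kernel, (3.71)) on the
unit lattice, where every site has size `1` and the prefactors `(L^jη)^{−p}(L^{j′}η)^{−d}` of the typed shape read `1`; their header listed
«(b) the multiscale carrier `𝔅 = ⋃_j Λ_j` with (3.133)'s prefactors» as NOT realised.  With Proposition 3.9 in the tree as a named predicate
(and, today, no consumer), the multiscale statement becomes a theorem about the two typed currencies.  THIS PART types the objects:
* §1 OBJECTS — `PointBlocking T` (the finite nonempty fibres of King's point map `x′ ↦ x`; no slack: (3.73) is stated at `x = pt x′`);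
  **`slicesGeo T M j`**: the points of `T_η` read as [B9] sites OF SCALE `j` (`len = L^jη` = `SliceKernels.slice`, `slicesGeo_len`), with
  [B9]'s scaled distance `(L^jη)^{−1}|x − y|` and KING'S SCALE-COVARIANT RATE FACTOR `(η∕L^jη)^γ = L^{−γk}(L^jη)^{−γ}` (**`rateFactor_slicesGeo`**
  — the design source `rateFactor_eq_king` instantiated); `slicesGeoHi` (the fine run: scale `j + n`, `η′`), `slicesPairing`, the index
  `SlicesIndex` (datum + point fibres + slice `j < k` + cube size `M ≥ 1` + `L > 1`), `slicesInstance`; the SUP-OVER-THE-FIBRES η-difference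
  entries `sliceEntry(x, y) = sup_{x′ ↦ x, y′ ↦ y} |G^{η′}_{(j)}(x′, y′) − G^η_{(j)}(x, y)|` and `dsliceEntry` (with `Σ_μ`), site kernels
  `slicesGSite` ∕ `slicesDGSite`;
* §2 STEP BOUNDS FROM PRINT: a (3.73)-line-1 bound at slice `j` ⇒ the same bound for `sliceEntry` (`sliceEntry_le_of_line1` — NO slack, no
  sign hypothesis: the right-hand side depends on the fine points through their coarse points only), hence from `Prop39Printed` BY NAME
  (**`sliceEntry_le_of_prop39Printed`**); the gradient line with the factor `d` (`dsliceEntry_le_of_line2`, **`dsliceEntry_le_of_prop39Printed`**).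
PART E (`…N15KingModelCurvedSlicesNode`) reads the layer off §2: the exact dictionary `EtaRateIneqSite d (−2) ⟺ (3.73) line 1` on this
carrier (same constants), `NE2PlusSite d (−2) c35` on Prop-3.9 families, the readout, `NE2ZeroSite`, the one-point member.
WHAT BAŁABAN'S CASE STILL ADDS (the abelian curved multiscale statement being consumed): (a) the NON-ABELIAN covariant `G(U)`, `G′(U)` of [B9]
Thms 3.1∕3.3 — King's slices are pieces of the OPERATOR-class propagator `G_k = Σ_j G_{(j)}` ((2.17) p. 653), read here POINTWISE as site
kernels; [B9]'s operator-layer reading (3.42) pairs with test functions, which the abstract schema does not carry (the `A = 0` top piece's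
operator reading is part 1's `ne2PlusOperator_topPiece`); (c) the LIVE WINDOW `∀ U, Reg335 c35 α₀ U → …` INSIDE one instance — here the
background is a parameter of the datum and the background sort is one-point; (d) an η-DIFFERENCE statement at all ([B9] prints analyticity
in `U`, Thm 3.4, and η-uniformity — `T4EtaRate` header).  Item (b) of parts A–C («multiscale carrier with the `(L^jη)`-prefactors») is
REALISED here in the model.
HONEST SCOPE.  (i) The contour line (3.74) (bond carrier) and the Hölder lines (3.75) ([B9]'s (3.43)–(3.45), untyped in `T4EtaRate`) are
carried inside `Prop39Printed` and NOT consumed (NB the schema quantifies (3.75) `∀ α ∈ (0, 1)` at fixed `(C, γ)`, cf. part A (i)).  (ii) Each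
member of the family is ONE slice `j` of ONE datum read on the points of `T_η` at scale `j` (a single-scale [B9] carrier); the multiscale
content is the family's range over `j < k` with the `j`-dependent lengths, prefactors and rate factors — no cross-slice kernel is posited.
(iii) The point-fibre structure is not part of the literature schema: it is the finiteness ∕ surjectivity of King's `x′ ↦ x` that a `sup`
presupposes, posited abstractly (`PointBlocking`).  (iv) No `A = 0` torus member of the slice family is constructed: the tree's `A = 0`
two-spacing theorem for propagator pieces is the TOP piece's on blocks (`King1986.Torus.topPiece_rate_blocks`, consumed by part 1 at the unit
scale); the internal slices' (3.73) at `A = 0` is King's (4.42)–(4.43) assembly (`King1986.SingleScaleRate.prod3_rate_king`, abstract) on his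
three concrete factors at two spacings, not assembled in the tree.
Locators: [King1986] C. King, CMP **102** (1986) 649–677: (2.17) p. 653, p. 656 (unit lattice), p. 663 (re-indexed fine slices), p. 664
(pairing sentence), Prop. 3.9 (3.73)–(3.75) p. 665, §4 (4.42)–(4.43) p. 675; [B9] = [Balaban1985BackgroundPropagators] CMP **99** (1985):
(3.35) p. 396, (3.41)–(3.42) p. 397, Thm 3.1 p. 397, Thm 3.2 (3.48) p. 398, Thm 3.4 p. 400, (3.132)–(3.133) p. 422, Thm 3.14 pp. 426–427
(typing template).
-/

noncomputable section

namespace Summit.QuantumFields.YangMills.BalabanUVNodes.N15KingModelRung.Curved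

open Real Finset
open Literature.MathematicalPhysics.QuantumFieldTheory.Balaban1983to89
open Literature.MathematicalPhysics.QuantumFieldTheory.Balaban1983to89.T4EtaRate (PairedInstance EtaPairing EtaRateIneqSite NE2PlusSite
  rateFactor rateFactor_eq_king)
open Literature.MathematicalPhysics.QuantumFieldTheory.Balaban1983to89.T4EtaRateSiteOfRatePair (NE2ZeroSite ne2ZeroSite_of_ne2PlusSite)
open Literature.MathematicalPhysics.QuantumFieldTheory.Balaban1983to89.T4EtaRateDefectSite (pt9Bg)
open Literature.MathematicalPhysics.QuantumFieldTheory.King1986.ContinuumLimit (eps eps_pos)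
open Literature.MathematicalPhysics.QuantumFieldTheory.King1986.SlicePropagator (SliceKernels TwoSpacing Prop39Printed)

variable {d : ℕ}

/-! ## §1 The objects: point fibres, the slice carrier of scale `j`, the pairing, the index, the sup entries -/

section Object

/-- THE POINT-FIBRE STRUCTURE of a two-spacing datum: `fibre x` = the finite set of fine points `x′ ∈ T_{η′}` with `x′ ∈ B^n(x)` (King
p. 664: *"When x′ ∈ T_{η′}, we denote by x that point in T_η for which x′ ∈ B^n(x)"*), i.e. the fibre of the datum's point map `pt`, assumed
finite and nonempty (every coarse point carries a fine point) — exactly what a `sup` over the fibre presupposes; no metric slack (HONEST SCOPE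
(iii)). [cite: King1986, p.664 (convention before Prop. 3.8)] -/
structure PointBlocking (T : TwoSpacing d) where
  /-- the fine points over a coarse point -/
  fibre : T.lo.S → Finset T.hi.S
  /-- membership: `x′` is over `x` iff `x` is the point of `x′` -/
  mem_fibre : ∀ (x : T.lo.S) (x' : T.hi.S), x' ∈ fibre x ↔ T.pt x' = x
  /-- every coarse point carries a fine point -/
  fibre_nonempty : ∀ x, (fibre x).Nonempty

/-- THE COARSE RUN'S POINTS AS A [B9] SITE CARRIER OF SCALE `j`: sites = the points of `T_η`, every site of scale index `j` (physical size
`L^jη`, the range of the slice `G^η_{(j)}`), [B9]'s scaled distance `(L^jη)^{−1}|x − y|` ((3.41) p. 397; King's exponent in (3.73)),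
`η = L^{−k}` (`SliceKernels.η`), block factor `L`, cube size `M` (an index parameter, inert — carried so that the guard `M₅ ≤ M` of the packaged
shapes is co-final); argument ∕ cut-off sorts inert. [cite: Balaban1985BackgroundPropagators, (3.41) p.397 (site scale and scaled distance); King1986, Prop. 3.9 (3.73) p.665 (slice length `L^jη`)] -/
@[reducible] def slicesGeo (T : TwoSpacing d) (M : ℝ) (j : ℕ) : B9.Geometry where
  Site := T.lo.S
  scale := fun _ => j
  dist := fun x y => (T.lo.slice j)⁻¹ * T.lo.dist x y
  k := T.lo.k
  eta := T.lo.η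
  L := T.lo.L
  M := M
  Loc := Unit
  suppIn := fun _ _ => True
  suppInT := fun _ _ => True
  supNorm := fun _ => 0
  l2Norm := fun _ => 0
  wNorm := fun _ _ => 0
  holder := fun _ _ => 0
  Cut := Unit
  cutIn := fun _ _ => True
  cutInT := fun _ _ => True
  cutH := fun _ _ => 0
  cutSup := fun _ => 0
  suppInT_of_suppIn := fun _ _ h => h
  cutInT_of_cutIn := fun _ _ h => h

/-- THE FINE RUN'S GEOMETRY ON THE SAME POINTS (King re-indexes the fine slices so that `G^{η′}_{(j)}` has the physical size `L^jη` of
`G^η_{(j)}`, p. 663: *"if we replace G^η_{(j)} by G^{η′}_{(j)} throughout … the bounds are valid for −n ≤ j ≤ k − 1"*): scale index `j + n`,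
`η′ = L^{−(k+n)}`, same sites and distance. [cite: King1986, p.663 (re-indexed fine slices), p.664 (two spacings)] -/
@[reducible] def slicesGeoHi (T : TwoSpacing d) (M : ℝ) (j : ℕ) : B9.Geometry where
  Site := T.lo.S
  scale := fun _ => j + T.n
  dist := fun x y => (T.lo.slice j)⁻¹ * T.lo.dist x y
  k := T.hi.k
  eta := T.hi.η
  L := T.hi.L
  M := M
  Loc := Unit
  suppIn := fun _ _ => True
  suppInT := fun _ _ => True
  supNorm := fun _ => 0
  l2Norm := fun _ => 0
  wNorm := fun _ _ => 0
  holder := fun _ _ => 0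
  Cut := Unit
  cutIn := fun _ _ => True
  cutInT := fun _ _ => True
  cutH := fun _ _ => 0
  cutSup := fun _ => 0
  suppInT_of_suppIn := fun _ _ h => h
  cutInT_of_cutIn := fun _ _ h => h

section Carrier

variable (T : TwoSpacing d) (M : ℝ) (j : ℕ)

/-- The carrier's distance is [B9]'s scaled distance `(L^jη)^{−1}|x − y|`. [cite: Balaban1985BackgroundPropagators, (3.41) p.397] -/
@[simp] theorem slicesGeo_dist (x y : (slicesGeo T M j).Site) : (slicesGeo T M j).dist x y = (T.lo.slice j)⁻¹ * T.lo.dist x y := rfl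

/-- Every site of the slice carrier has physical size `L^jη` — the slice length of (3.63)∕(3.73) (`SliceKernels.slice`). [cite: King1986, Prop. 3.9 (3.73) p.665] -/
theorem slicesGeo_len (x : (slicesGeo T M j).Site) : (slicesGeo T M j).len x = T.lo.slice j := rfl

/-- **KING'S SCALE-COVARIANT RATE FACTOR ON THE SLICE CARRIER IS THE PRINTED `L^{−γk}(L^jη)^{−γ}`**: `(η∕L^jη)^γ = L^{−γk}·(L^jη)^{−γ}`
(`T4EtaRate.rateFactor_eq_king` — the typed shape's design source — instantiated at `η = L^{−k}`). [cite: King1986, Prop. 3.9 (3.73) p.665 (the factor `L^{−γk}(L^jη)^{−γ}`)] -/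
theorem rateFactor_slicesGeo (hL : 0 < T.lo.L) (γ : ℝ) (x : (slicesGeo T M j).Site) :
    rateFactor (slicesGeo T M j) γ x = (T.lo.L : ℝ) ^ (-(γ * T.lo.k)) * (T.lo.slice j) ^ (-γ) := by
  have hL' : (0 : ℝ) < (T.lo.L : ℝ) := by exact_mod_cast hL
  rw [rateFactor_eq_king (g := slicesGeo T M j) rfl hL' γ x, slicesGeo_len]
  congr 1
  show ((T.lo.L : ℝ) ^ T.lo.k) ^ (-γ) = (T.lo.L : ℝ) ^ (-(γ * T.lo.k))
  rw [← Real.rpow_natCast, ← Real.rpow_mul hL'.le]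
  congr 1
  ring

end Carrier

/-- THE η-PAIRING OF THE TWO RUNS on the slice carrier: `n` extra scales (`η′L^n = η`), the scale index shifted by `n` (same physical size,
`EtaPairing.len_ι`), points ∕ arguments ∕ backgrounds transported identically (King's point map acts on the fine points inside the sup entries
below). [cite: King1986, p.663 (re-indexed fine slices), p.664 (convention before Prop. 3.8)] -/
def slicesPairing (T : TwoSpacing d) (hL : 0 < T.lo.L) (M : ℝ) (j : ℕ) :
    EtaPairing (slicesGeo T M j) (slicesGeoHi T M j) pt9Bg pt9Bg where
  n := T.n
  k_eq := T.k_hi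
  L_eq := by
    show ((T.hi.L : ℕ) : ℝ) = ((T.lo.L : ℕ) : ℝ)
    rw [T.L_hi]
  M_eq := rfl
  eta_eq := by
    show eps T.hi.L T.hi.k * ((T.hi.L : ℕ) : ℝ) ^ T.n = eps T.lo.L T.lo.k
    rw [T.L_hi, T.k_hi]
    have hL' : (T.lo.L : ℝ) ≠ 0 := by exact_mod_cast hL.ne'
    simp only [eps]
    rw [pow_add, mul_inv, mul_assoc, inv_mul_cancel₀ (pow_ne_zero _ hL'), mul_one]
  ι := fun x => x
  scale_ι := fun _ => rfl
  dist_ι := fun _ _ => rfl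
  τ := fun lam => lam
  suppIn_τ := fun _ _ h => h
  supNorm_τ := fun _ => le_rfl
  avg := fun U => U
  avg_one := rfl

/-- THE INDEX OF THE SLICE FAMILY: a two-spacing datum (its background `A` a parameter of the data), its point fibres, an internal slice
`j < k` (Prop. 3.9's range `0 ≤ j ≤ k − 1`), the cube size `M ≥ 1` (co-final guard) and `L > 1`. [cite: King1986, Prop. 3.9 p.665 (range of `j`)] -/
structure SlicesIndex (d : ℕ) where
  /-- the two-spacing datum -/
  T : TwoSpacing d
  /-- its point fibres -/
  β : PointBlocking T
  /-- the slice -/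
  j : ℕ
  /-- `j ≤ k − 1` -/
  j_lt : j + 1 ≤ T.lo.k
  /-- [B9]'s cube-size parameter -/
  M : ℝ
  /-- `M ≥ 1` -/
  one_le_M : 1 ≤ M
  /-- `L > 1` -/
  one_lt_L : 1 < T.lo.L

/-- `L > 0` on an index. [folklore] -/
theorem SlicesIndex.L_pos (i : SlicesIndex d) : 0 < i.T.lo.L := lt_trans zero_lt_one i.one_lt_L

/-- The slice length `L^jη > 0` on an index. [cite: King1986, (3.63) p.663] -/
theorem SlicesIndex.slice_pos (i : SlicesIndex d) : 0 < i.T.lo.slice i.j := i.T.lo.slice_pos i.L_pos i.j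

/-- THE PAIRED INSTANCE of an index: the two runs' slice-`j` geometries over the one-point background sort (the background is a parameter of
the datum; item (c) of the header). [folklore] -/
def slicesInstance (i : SlicesIndex d) : PairedInstance where
  gc := slicesGeo i.T i.M i.j
  gf := slicesGeoHi i.T i.M i.j
  Bc := pt9Bg
  Bf := pt9Bg
  pair := slicesPairing i.T i.L_pos i.M i.j

variable {T : TwoSpacing d}

/-- **THE SLICE's η-DIFFERENCE SUP ENTRY WITH THE BACKGROUND** at coarse points `x, y`: `sup_{x′ ↦ x, y′ ↦ y} |G^{η′}_{(j)}(x′, y′) − G^η_{(j)}(x, y)|`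
— every pair of fine points over `(x, y)` is read (the η-difference of the slice kernel seen on the coarse points; [B9] Thm 3.14's «difference
satisfies the same inequalities» pattern). [cite: King1986, Prop. 3.9 (3.73) p.665 (first line, object); Balaban1985BackgroundPropagators, Thm 3.14 pp.426–427 (difference-family template)] -/
def sliceEntry (β : PointBlocking T) (j : ℕ) (x y : T.lo.S) : ℝ :=
  (β.fibre x ×ˢ β.fibre y).sup' ((β.fibre_nonempty x).product (β.fibre_nonempty y))
    fun q => |T.hi.G j q.1 q.2 - T.lo.G j x y|

/-- **THE GRADIENT SLICE's SUP ENTRY**: `sup_{x′ ↦ x, y′ ↦ y} Σ_μ |∂^{η′}_μG^{η′}_{(j)}(x′, y′) − ∂^η_μG^η_{(j)}(x, y)|`. [cite: King1986, Prop. 3.9 (3.73) p.665 (second line, object)] -/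
def dsliceEntry (β : PointBlocking T) (j : ℕ) (x y : T.lo.S) : ℝ :=
  (β.fibre x ×ˢ β.fibre y).sup' ((β.fibre_nonempty x).product (β.fibre_nonempty y))
    fun q => ∑ μ : Fin d, |T.hi.dG j μ q.1 q.2 - T.lo.dG j μ x y|

/-- The pointwise difference at a pair of fine points is dominated by the sup entry at their coarse points. [folklore] -/
theorem abs_sub_le_sliceEntry (β : PointBlocking T) (j : ℕ) (x' y' : T.hi.S) :
    |T.hi.G j x' y' - T.lo.G j (T.pt x') (T.pt y')| ≤ sliceEntry β j (T.pt x') (T.pt y') := by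
  have hq : (x', y') ∈ β.fibre (T.pt x') ×ˢ β.fibre (T.pt y') :=
    Finset.mk_mem_product ((β.mem_fibre _ _).2 rfl) ((β.mem_fibre _ _).2 rfl)
  exact Finset.le_sup' (fun q : T.hi.S × T.hi.S => |T.hi.G j q.1 q.2 - T.lo.G j (T.pt x') (T.pt y')|) hq

/-- The pointwise gradient difference (summed over directions) is dominated by the gradient sup entry. [folklore] -/
theorem sum_abs_sub_le_dsliceEntry (β : PointBlocking T) (j : ℕ) (x' y' : T.hi.S) :
    ∑ μ : Fin d, |T.hi.dG j μ x' y' - T.lo.dG j μ (T.pt x') (T.pt y')| ≤ dsliceEntry β j (T.pt x') (T.pt y') := by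
  have hq : (x', y') ∈ β.fibre (T.pt x') ×ˢ β.fibre (T.pt y') :=
    Finset.mk_mem_product ((β.mem_fibre _ _).2 rfl) ((β.mem_fibre _ _).2 rfl)
  exact Finset.le_sup' (fun q : T.hi.S × T.hi.S => ∑ μ : Fin d, |T.hi.dG j μ q.1 q.2 - T.lo.dG j μ (T.pt x') (T.pt y')|) hq

/-- The sup entry is nonnegative. [folklore] -/
theorem sliceEntry_nonneg (β : PointBlocking T) (j : ℕ) (x y : T.lo.S) : 0 ≤ sliceEntry β j x y := by
  obtain ⟨q, hq⟩ := (β.fibre_nonempty x).product (β.fibre_nonempty y)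
  exact (abs_nonneg _).trans (Finset.le_sup' (fun q : T.hi.S × T.hi.S => |T.hi.G j q.1 q.2 - T.lo.G j x y|) hq)

/-- The gradient sup entry is nonnegative. [folklore] -/
theorem dsliceEntry_nonneg (β : PointBlocking T) (j : ℕ) (x y : T.lo.S) : 0 ≤ dsliceEntry β j x y := by
  obtain ⟨q, hq⟩ := (β.fibre_nonempty x).product (β.fibre_nonempty y)
  exact (Finset.sum_nonneg fun μ _ => abs_nonneg _).trans
    (Finset.le_sup' (fun q : T.hi.S × T.hi.S => ∑ μ : Fin d, |T.hi.dG j μ q.1 q.2 - T.lo.dG j μ x y|) hq)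

/-- THE SLICE's η-difference WITH THE BACKGROUND as a SITE kernel on the slice family. [cite: King1986, Prop. 3.9 (3.73) p.665 (object); Balaban1985BackgroundPropagators, Thm 3.2 (3.48) p.398 (site-kernel shape)] -/
def slicesGSite : ∀ i : SlicesIndex d, B9.SiteKernel (slicesInstance i).gc (slicesInstance i).Bf :=
  fun i => ⟨fun _ x y => sliceEntry i.β i.j x y⟩

/-- Its gradient companion as a SITE kernel. [cite: King1986, Prop. 3.9 (3.73) p.665 (second line, object); Balaban1985BackgroundPropagators, Thm 3.2 (3.48) p.398 (shape)] -/
def slicesDGSite : ∀ i : SlicesIndex d, B9.SiteKernel (slicesInstance i).gc (slicesInstance i).Bf :=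
  fun i => ⟨fun _ x y => dsliceEntry i.β i.j x y⟩

end Object

/-! ## §2 The step bounds FROM PRINT: Proposition 3.9 (3.73), lines 1–2 at slice `j`, by name ⇒ the sup entries' bound (no slack) -/

section Step

variable {T : TwoSpacing d}

/-- **A (3.73)-LINE-1 BOUND AT SLICE `j`, READ OVER THE FIBRES**: if `|G^{η′}_{(j)}(x′, y′) − G^η_{(j)}(x, y)| ≤ C·L^{−γk}(L^jη)^{2−d−γ}·e^{−δ₀(L^jη)^{−1}|x−y|}`
for all fine `x′, y′` (`x, y` their points), then the sup entry at every pair of coarse points obeys the SAME bound — no slack, no sign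
hypothesis (the right-hand side depends on `x′, y′` through `x, y` only). [cite: King1986, Prop. 3.9 (3.73) p.665 (first line, shape)] [folklore] -/
theorem sliceEntry_le_of_line1 (β : PointBlocking T) {j : ℕ} {C δ₀ γ : ℝ}
    (h1 : ∀ x' y' : T.hi.S, |T.hi.G j x' y' - T.lo.G j (T.pt x') (T.pt y')|
      ≤ C * (T.lo.L : ℝ) ^ (-(γ * T.lo.k)) * (T.lo.slice j) ^ ((2 : ℝ) - d - γ)
        * Real.exp (-(δ₀ * (T.lo.slice j)⁻¹ * T.lo.dist (T.pt x') (T.pt y'))))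
    (x y : T.lo.S) :
    sliceEntry β j x y ≤ C * (T.lo.L : ℝ) ^ (-(γ * T.lo.k)) * (T.lo.slice j) ^ ((2 : ℝ) - d - γ)
        * Real.exp (-(δ₀ * (T.lo.slice j)⁻¹ * T.lo.dist x y)) := by
  refine Finset.sup'_le _ _ fun q hq => ?_
  obtain ⟨hx, hy⟩ := Finset.mem_product.mp hq
  have hx' : T.pt q.1 = x := (β.mem_fibre x q.1).1 hx
  have hy' : T.pt q.2 = y := (β.mem_fibre y q.2).1 hy
  have h := h1 q.1 q.2
  rw [hx', hy'] at h
  exact h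

/-- **(3.73) LINE 1 AT SLICE `j`, BY NAME (`Prop39Printed`), READ OVER THE FIBRES**: `Prop39Printed T C δ₀ γ` gives, for `j ≤ k − 1` and all coarse
points `x, y`, `sup_{x′ ↦ x, y′ ↦ y} |G^{η′}_{(j)}(x′, y′) − G^η_{(j)}(x, y)| ≤ C·L^{−γk}(L^jη)^{2−d−γ}·e^{−δ₀(L^jη)^{−1}|x−y|}`. [cite: King1986, Prop. 3.9 (3.73) p.665 (first line)] -/
theorem sliceEntry_le_of_prop39Printed (β : PointBlocking T) {C δ₀ γ : ℝ} (h39 : Prop39Printed T C δ₀ γ) {j : ℕ}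
    (hj : j + 1 ≤ T.lo.k) (x y : T.lo.S) :
    sliceEntry β j x y ≤ C * (T.lo.L : ℝ) ^ (-(γ * T.lo.k)) * (T.lo.slice j) ^ ((2 : ℝ) - d - γ)
        * Real.exp (-(δ₀ * (T.lo.slice j)⁻¹ * T.lo.dist x y)) :=
  sliceEntry_le_of_line1 β (fun x' y' => ((h39 j hj).1 x' y').1) x y

/-- **A (3.73)-LINE-2 BOUND AT SLICE `j`, READ OVER THE FIBRES**: the gradient sup entry obeys
`≤ d·C·L^{−γk}(L^jη)^{1−d−γ}·e^{−δ₀(L^jη)^{−1}|x−y|}` (`d` directions). [cite: King1986, Prop. 3.9 (3.73) p.665 (second line, shape)] [folklore] -/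
theorem dsliceEntry_le_of_line2 (β : PointBlocking T) {j : ℕ} {C δ₀ γ : ℝ}
    (h2 : ∀ (x' y' : T.hi.S) (μ : Fin d), |T.hi.dG j μ x' y' - T.lo.dG j μ (T.pt x') (T.pt y')|
      ≤ C * (T.lo.L : ℝ) ^ (-(γ * T.lo.k)) * (T.lo.slice j) ^ ((1 : ℝ) - d - γ)
        * Real.exp (-(δ₀ * (T.lo.slice j)⁻¹ * T.lo.dist (T.pt x') (T.pt y'))))
    (x y : T.lo.S) :
    dsliceEntry β j x y ≤ d * C * (T.lo.L : ℝ) ^ (-(γ * T.lo.k)) * (T.lo.slice j) ^ ((1 : ℝ) - d - γ)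
        * Real.exp (-(δ₀ * (T.lo.slice j)⁻¹ * T.lo.dist x y)) := by
  refine Finset.sup'_le _ _ fun q hq => ?_
  obtain ⟨hx, hy⟩ := Finset.mem_product.mp hq
  have hx' : T.pt q.1 = x := (β.mem_fibre x q.1).1 hx
  have hy' : T.pt q.2 = y := (β.mem_fibre y q.2).1 hy
  calc ∑ μ : Fin d, |T.hi.dG j μ q.1 q.2 - T.lo.dG j μ x y|
      ≤ ∑ _μ : Fin d, C * (T.lo.L : ℝ) ^ (-(γ * T.lo.k)) * (T.lo.slice j) ^ ((1 : ℝ) - d - γ)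
          * Real.exp (-(δ₀ * (T.lo.slice j)⁻¹ * T.lo.dist x y)) :=
        Finset.sum_le_sum fun μ _ => by
          have h := h2 q.1 q.2 μ
          rw [hx', hy'] at h
          exact h
    _ = d * C * (T.lo.L : ℝ) ^ (-(γ * T.lo.k)) * (T.lo.slice j) ^ ((1 : ℝ) - d - γ)
          * Real.exp (-(δ₀ * (T.lo.slice j)⁻¹ * T.lo.dist x y)) := by
        rw [Finset.sum_const, Finset.card_univ, Fintype.card_fin, nsmul_eq_mul]
        ring

/-- **(3.73) LINE 2 AT SLICE `j`, BY NAME (`Prop39Printed`), READ OVER THE FIBRES**: the gradient sup entry obeys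
`≤ d·C·L^{−γk}(L^jη)^{1−d−γ}·e^{−δ₀(L^jη)^{−1}|x−y|}`. [cite: King1986, Prop. 3.9 (3.73) p.665 (second line)] -/
theorem dsliceEntry_le_of_prop39Printed (β : PointBlocking T) {C δ₀ γ : ℝ} (h39 : Prop39Printed T C δ₀ γ) {j : ℕ}
    (hj : j + 1 ≤ T.lo.k) (x y : T.lo.S) :
    dsliceEntry β j x y ≤ d * C * (T.lo.L : ℝ) ^ (-(γ * T.lo.k)) * (T.lo.slice j) ^ ((1 : ℝ) - d - γ)
        * Real.exp (-(δ₀ * (T.lo.slice j)⁻¹ * T.lo.dist x y)) :=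
  dsliceEntry_le_of_line2 β (fun x' y' μ => ((h39 j hj).1 x' y').2 μ) x y

end Step

end Summit.QuantumFields.YangMills.BalabanUVNodes.N15KingModelRung.Curved

end
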